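/-
Origin: expansion seat `planner-pub-hodgecm-mc-glue-1-g11-0`, handover #SG28 2026-08-20T16:55:47Z md5 3dc77a550011 (REPLACE; pre md5 27332db514d0 → new md5 3dc77a550011; 113 l.; (μ4) scope-guard rewrite of the RUN-55 installed file; family glue-1; compiled ok 0 proof-hole) (`HOME/mc/pub-hodgecm-mc-glue-1-g11/stage56/HodgeCM/Model/E2InstanceOGR21AEPISTR2DJWHH.lean`, md5 3dc77a550011, 113 lines);
landed by the second packager p2 gen 10 (p2-g10) in gate run 56 REPLACES the earlier landed copy of `HodgeCM/Model/E2InstanceOGR21AEPISTR2DJWHH.lean` (seat copy carried the packager Origin header of an earlier run (stripped)).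
-/
/-
Origin: CONSTRUCTION seat `planner-pub-hodgecm-mc-glue-1-g11-0` (unit pub-hodgecm-mc-glue-1-g11, gen 11 of mc-glue-1, node E ASSEMBLER), 2026-08-20,
generated from glue-1's installed #397J2 `HodgeCM/Model/E2InstanceOGR21AEPISTR2DJ.lean` (RUN 51) by `tools/gen_child.py spec/str2djwhh.json` (remove groups
`W hyp12 hyp34`; the three proof terms are the installed R1 leaf #398HH `E2InstanceOGR21AEPISTRDJWHH.lean` :108–:115 with the single token swap
`SInstance.SROGTC ↦ SInstance.SROGT'C`); KERNEL only: 1 theorem, 0 defs; intended closure {propext, Classical.choice, Quot.sound}.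
Target in PKG: HodgeCM/Model/E2InstanceOGR21AEPISTR2DJWHH.lean (NEW additive leaf; imports #397J2 + binder-2's `HypCensus/KappaJoinMu` + `HypCensus/KappaJoinMu34`,
all PKG-landed; nothing landed imports it).
-/
import Summits.HodgeConjecture.HodgeCM.Model.E2InstanceOGR21AEPISTR2DJ
import Summits.HodgeConjecture.HodgeCM.Model.HypCensus.KappaJoinMu
import Summits.HodgeConjecture.HodgeCM.Model.HypCensus.KappaJoinMu34

noncomputable section

open scoped TensorProduct InnerProductSpace Matrix

open Literature.NumberTheory.Automorphic Literature.NumberTheory.Weil1964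
open Literature.NumberTheory.GelbartRogawski1991.UnitaryDualPair
open HodgeCM.Adelic HodgeCM.PerL34
open scoped Classical
open Literature.Geometry.ComplexHyperbolic.BallModel (U21 x₀ stabilizerEquivK21)
open Literature.NumberTheory.Automorphic.U21 (K21 matA sclD)

/-!
# E2InstanceOGR21AEPISTR2DJWHH — the R2 twin of #398HH: #397J2 with row 4 `W` PINNED and BOTH torus junctions of rows 18/19 STRUCK

`perL_picardCM_r21AEOGISTR2DJWHH` = glue-1's installed #397J2 `perL_picardCM_r21AEOGISTR2DJ` (RUN 51; 14 groups `hA W hGR hGR₀ hGR₁ hGR₂ hGR₃ μ hR hΘ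
gen12 real34 hyp12 hyp34`; rows 5/12/13/14/15 discharged at the R2 pin `SInstance.SROGT'CJ hGR hGR₀ hGR₁ hGR₂ hGR₃ μ` with NO PROVE input) with
* row 4 `W` PINNED at `HypCensus.Wcm hGR η″ hη″ hηc″`, `η″ := EtaChi.η (SInstance.χVR hGR hGR₀ hGR₁) (SInstance.χWR hGR hGR₀ hGR₁ μ♯♯)`, `μ♯♯ := muSharp₂₃ μ`
  (the W pin of #398J ∕ #398HH ∕ #398J2W, byte for byte);
* row 18 `hyp12 := fun V c hc h6 hcan => HypCensus.hyp12_of_census_R1At_GOG … S μ V c hc h6 hcan (fun _ _ => 0)` — binder-2's RUN-51 #80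
  `HypCensus/KappaJoinMu` ((V-val) #78 `hκ_of_hasArchType_pairType`, (J-dense) #70, (J-T12) #N3 `omgW_ins_eq_of_weight` ∘ theta-3 (K13) `hμ_GOG`), whose
  side family `S` IS FREE (KappaJoinMu :122) — here `S :=` the R2 pin `SInstance.SROGT'C hGR hGR₀..₃ μ♯♯ (hΔ₁_GOG_muSharp₂₃ …) (hΔ₂∕₃_GOG_muSharp₂₃ … (hSV_holds hGR))`
  (= `SROGT'CJ … μ`, rfl) where #398HH passed the R1 pin `SROGTC …` — the ONLY token that differs from #398HH's proof (`SROGTC ↦ SROGT'C`, 2 occurrences);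
* row 19 `hyp34 := … HypCensus.hyp34_of_census_R1At_GOG …` — binder-2's S5b #N5 `HypCensus/KappaJoinMu34` (#78 at σ := sigma34 ∘ #N4 `omgW_ins₃₄_eq_of_weight`
  ∘ theta-3 (K14) `hμ₃₄_GOG`), `S` free likewise (KappaJoinMu34 :123), same instantiation.
Binder groups 14 → 11: `hA hGR hGR₀ hGR₁ hGR₂ hGR₃ μ hR hΘ gen12 real34` — the R2 lineage now stands where the R1 lineage stands (#398HH «11»): rows 4/5/12/13/14/15/18/19
discharged or pinned, rows 9 `hΘ` ∕ 16 `gen12` ∕ 17 `real34` displayed AS TYPED at (W, S) := (`Wcm … η″`, `SROGT'CJ … μ`); conclusion `Universe.PerL`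
unchanged; proof = ONE application of #397J2.  ADDITIVE SIBLING LEAF beside E; E's term of record `perL_picardCM_r21AEOGI` «14 · 0» untouched; no new
definition, record or cite enters; nothing of PerL ∕ QW8 is claimed.
-/

namespace HodgeCM

namespace Model

open HodgeCM.Model.ArchSideTerm
open HodgeCM.Universe (AdelicThetaCore AdelicThetaCore₀ SideData ThetaModel ModelAxiomsPerL)
open Literature.AlgebraicGeometry.HodgeTheory
open Literature.AlgebraicGeometry.ComplexMultiplication (Shimura1998_Thm3_isogenousPower Shimura1998_Thm2_Cor)
open Literature.NumberTheory.Automorphic.PicardCM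
open Literature.NumberTheory.Transcendental (Arapura2012_Cor_15_4_6)
open HodgeCM.CMTypeOps (inflate)
open HodgeCM.Model.SupplyResidual (ClassSupplyPackN)
open HodgeCM.Model.ThetaSpace

variable (hHD : exists_isReal_hodgeModel) (hI : hodgePQ_independent_of_hodgeModel)
  (h₁ : BallQuotientUniformised)  (h₃ : CMAbelianVarietyEigenbasisRealised)

/-- **THE R2 TWIN OF #398HH** (`W := HypCensus.Wcm hGR η″ hη″ hηc″`; rows 18/19 := binder-2's `hyp12/34_of_census_R1At_GOG` at `S :=` the R2 pin):
11 binder groups `hA hGR hGR₀ hGR₁ hGR₂ hGR₃ μ hR hΘ gen12 real34`; one application of `perL_picardCM_r21AEOGISTR2DJ`. -/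
theorem perL_picardCM_r21AEOGISTR2DJWHH (hA : Arapura2012_Cor_15_4_6)
    (hGR : ∀ {L : CMField} {ι₁ : L →+* ℂ} (V : HermSpace3 L ι₁) (c : SeesawCtx L),
      (cmSplittingDatum (L : Type) finProdFinEquiv (frameD V) (frameD_real V) (frameD_ne V) (dW c.D) (dW_real c.D)
        (dW_ne c.D)).CompatibleSplitting)
    (hGR₀ : ∀ {L : CMField} {ι₁ : L →+* ℂ} (V : HermSpace3 L ι₁) (c : SeesawCtx L),
      (cmSplittingDatum (L : Type) (e₁) (frameD V) (frameD_real V) (frameD_ne V) (lineVec (L : Type) (dW c.D 0))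
        (fun _ => dW_real c.D 0) (fun _ => dW_ne c.D 0)).CompatibleSplitting)
    (hGR₁ : ∀ {L : CMField} {ι₁ : L →+* ℂ} (V : HermSpace3 L ι₁) (c : SeesawCtx L),
      (cmSplittingDatum (L : Type) (e₁) (frameD V) (frameD_real V) (frameD_ne V) (lineVec (L : Type) (dW c.D 1))
        (fun _ => dW_real c.D 1) (fun _ => dW_ne c.D 1)).CompatibleSplitting)
    (hGR₂ : ∀ {L : CMField} {ι₁ : L →+* ℂ} (V : HermSpace3 L ι₁) (c : SeesawCtx L),
      (cmSplittingDatum (L : Type) (e₁) (frameD V) (frameD_real V) (frameD_ne V) (lineVec (L : Type) (dW' c.D 0))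
        (fun _ => dW'_real c.D 0) (fun _ => dW'_ne c.D 0)).CompatibleSplitting)
    (hGR₃ : ∀ {L : CMField} {ι₁ : L →+* ℂ} (V : HermSpace3 L ι₁) (c : SeesawCtx L),
      (cmSplittingDatum (L : Type) (e₁) (frameD V) (frameD_real V) (frameD_ne V) (lineVec (L : Type) (dW' c.D 1))
        (fun _ => dW'_real c.D 1) (fun _ => dW'_ne c.D 1)).CompatibleSplitting)
    (μ : ∀ {L : CMField}, SeesawCtx L → Fin 4 → NumberField.InfinitePlace L → ℤ)
    (hR : DeligneMilne1982_Thm_6_20_full)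
    (hΘ : ∀ {L : CMField} {ι₁ : L →+* ℂ} (V : HermSpace3 L ι₁) (c : SeesawCtx L),
      (thetaModelOf hHD hI h₁ (cmAbelianVarietyRealised_of_eigenbasis hHD hI h₃) (orientBitι L ι₁) (embOf hHD hI h₁ (cmAbelianVarietyRealised_of_eigenbasis hHD hI h₃)) (coverOf hHD hI h₁ (cmAbelianVarietyRealised_of_eigenbasis hHD hI h₃) hA) (wmOfInput (HypCensus.Wcm hGR (EtaChi.η (@SInstance.χVR @hGR @hGR₀ @hGR₁) (@SInstance.χWR @hGR @hGR₀ @hGR₁ (ArchSideTerm.muSharp₂₃ @μ))) (EtaChi.hη (@SInstance.χVR @hGR @hGR₀ @hGR₁) (@SInstance.χWR @hGR @hGR₀ @hGR₁ (ArchSideTerm.muSharp₂₃ @μ))) (EtaChi.hηc (@SInstance.χVR @hGR @hGR₀ @hGR₁) (@SInstance.χWR @hGR @hGR₀ @hGR₁ (ArchSideTerm.muSharp₂₃ @μ))))) (thetaOf _ (thetaClassInputOf _ (fun V c => thetaSpaceInputOf hHD hI h₁ (cmAbelianVarietyRealised_of_eigenbasis hHD hI h₃) (SInstance.SROGT'C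 @hGR @hGR₀ @hGR₁ @hGR₂ @hGR₃ (ArchSideTerm.muSharp₂₃ @μ) (ArchSideTerm.hΔ₁_GOG_muSharp₂₃ @hGR @hGR₀ @hGR₁ @hGR₂ @hGR₃ @μ) (ArchSideTerm.hΔ₂_GOG_muSharp₂₃ @hGR @hGR₀ @hGR₁ @hGR₂ @hGR₃ @μ (ArchSideTerm.hSV_holds @hGR)) (ArchSideTerm.hΔ₃_GOG_muSharp₂₃ @hGR @hGR₀ @hGR₁ @hGR₂ @hGR₃ @μ (ArchSideTerm.hSV_holds @hGR))) V c))) (d12Of (ArchSideTerm.muSharp₂₃ @μ)) (d34Of (ArchSideTerm.muSharp₂₃ @μ))).GoodCtx ι₁ c → Module.finrank ℚ c.K = 6 ∧ IsNormalClosure ℚ c.K L ∧ (Module.finrank ℚ L = 24 ∨ Module.finrank ℚ L = 48) →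
      (NumberField.InfinitePlace.mk ι₁).embedding = ι₁ →
      ∀ i : Fin 4, ∃ Γ₀ : Level V, ∀ Γ ≤ Γ₀,
        ∃ D : CommonReflexInput c.K (c.Ψ i) c.σ,
          (thetaModelOf hHD hI h₁ (cmAbelianVarietyRealised_of_eigenbasis hHD hI h₃) (orientBitι L ι₁) (embOf hHD hI h₁ (cmAbelianVarietyRealised_of_eigenbasis hHD hI h₃)) (coverOf hHD hI h₁ (cmAbelianVarietyRealised_of_eigenbasis hHD hI h₃) hA) (wmOfInput (HypCensus.Wcm hGR (EtaChi.η (@SInstance.χVR @hGR @hGR₀ @hGR₁) (@SInstance.χWR @hGR @hGR₀ @hGR₁ (ArchSideTerm.muSharp₂₃ @μ))) (EtaChi.hη (@SInstance.χVR @hGR @hGR₀ @hGR₁) (@SInstance.χWR @hGR @hGR₀ @hGR₁ (ArchSideTerm.muSharp₂₃ @μ))) (EtaChi.hηc (@SInstance.χVR @hGR @hGR₀ @hGR₁) (@SInstance.χWR @hGR @hGR₀ @hGR₁ (ArchSideTerm.muSharp₂₃ @μ))))) (thetaOf _ (thetaClassInputOf _ (fun V c => thetaSpaceInputOf hHD hI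 h₁ (cmAbelianVarietyRealised_of_eigenbasis hHD hI h₃) (SInstance.SROGT'C @hGR @hGR₀ @hGR₁ @hGR₂ @hGR₃ (ArchSideTerm.muSharp₂₃ @μ) (ArchSideTerm.hΔ₁_GOG_muSharp₂₃ @hGR @hGR₀ @hGR₁ @hGR₂ @hGR₃ @μ) (ArchSideTerm.hΔ₂_GOG_muSharp₂₃ @hGR @hGR₀ @hGR₁ @hGR₂ @hGR₃ @μ (ArchSideTerm.hSV_holds @hGR)) (ArchSideTerm.hΔ₃_GOG_muSharp₂₃ @hGR @hGR₀ @hGR₁ @hGR₂ @hGR₃ @μ (ArchSideTerm.hSV_holds @hGR))) V c))) (d12Of (ArchSideTerm.muSharp₂₃ @μ)) (d34Of (ArchSideTerm.muSharp₂₃ @μ))).Theta V c i Γ ⊆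
            Submodule.span ℂ (D.surfaceClasses hHD hI h₁ (cmAbelianVarietyRealised_of_eigenbasis hHD hI h₃) V Γ))
    (gen12 : ∀ {L : CMField} {ι₁ : L →+* ℂ} (V : HermSpace3 L ι₁) (c : SeesawCtx L),
      (thetaModelOf hHD hI h₁ (cmAbelianVarietyRealised_of_eigenbasis hHD hI h₃) (orientBitι L ι₁) (embOf hHD hI h₁ (cmAbelianVarietyRealised_of_eigenbasis hHD hI h₃)) (coverOf hHD hI h₁ (cmAbelianVarietyRealised_of_eigenbasis hHD hI h₃) hA) (wmOfInput (HypCensus.Wcm hGR (EtaChi.η (@SInstance.χVR @hGR @hGR₀ @hGR₁) (@SInstance.χWR @hGR @hGR₀ @hGR₁ (ArchSideTerm.muSharp₂₃ @μ))) (EtaChi.hη (@SInstance.χVR @hGR @hGR₀ @hGR₁) (@SInstance.χWR @hGR @hGR₀ @hGR₁ (ArchSideTerm.muSharp₂₃ @μ))) (EtaChi.hηc (@SInstance.χVR @hGR @hGR₀ @hGR₁) (@SInstance.χWR @hGR @hGR₀ @hGR₁ (ArchSideTerm.muSharp₂₃ @μ))))) (thetaOf _ (thetaClassInputOf _ (fun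 V c => thetaSpaceInputOf hHD hI h₁ (cmAbelianVarietyRealised_of_eigenbasis hHD hI h₃) (SInstance.SROGT'C @hGR @hGR₀ @hGR₁ @hGR₂ @hGR₃ (ArchSideTerm.muSharp₂₃ @μ) (ArchSideTerm.hΔ₁_GOG_muSharp₂₃ @hGR @hGR₀ @hGR₁ @hGR₂ @hGR₃ @μ) (ArchSideTerm.hΔ₂_GOG_muSharp₂₃ @hGR @hGR₀ @hGR₁ @hGR₂ @hGR₃ @μ (ArchSideTerm.hSV_holds @hGR)) (ArchSideTerm.hΔ₃_GOG_muSharp₂₃ @hGR @hGR₀ @hGR₁ @hGR₂ @hGR₃ @μ (ArchSideTerm.hSV_holds @hGR))) V c))) (d12Of (ArchSideTerm.muSharp₂₃ @μ)) (d34Of (ArchSideTerm.muSharp₂₃ @μ))).GoodCtx ι₁ c → Module.finrank ℚ c.K = 6 ∧ IsNormalClosure ℚ c.K L ∧ (Module.finrank ℚ L = 24 ∨ Module.finrank ℚ L = 48) →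
      (NumberField.InfinitePlace.mk ι₁).embedding = ι₁ →
      Nonempty ((thetaModelOf hHD hI h₁ (cmAbelianVarietyRealised_of_eigenbasis hHD hI h₃) (orientBitι L ι₁) (embOf hHD hI h₁ (cmAbelianVarietyRealised_of_eigenbasis hHD hI h₃)) (coverOf hHD hI h₁ (cmAbelianVarietyRealised_of_eigenbasis hHD hI h₃) hA) (wmOfInput (HypCensus.Wcm hGR (EtaChi.η (@SInstance.χVR @hGR @hGR₀ @hGR₁) (@SInstance.χWR @hGR @hGR₀ @hGR₁ (ArchSideTerm.muSharp₂₃ @μ))) (EtaChi.hη (@SInstance.χVR @hGR @hGR₀ @hGR₁) (@SInstance.χWR @hGR @hGR₀ @hGR₁ (ArchSideTerm.muSharp₂₃ @μ))) (EtaChi.hηc (@SInstance.χVR @hGR @hGR₀ @hGR₁) (@SInstance.χWR @hGR @hGR₀ @hGR₁ (ArchSideTerm.muSharp₂₃ @μ))))) (thetaOf _ (thetaClassInputOf _ (fun V c => thetaSpaceInputOf hHD hI h₁ (cmAbelianVarietyRealised_of_eigenbasis hHD hI h₃) (SInstance.SROGT'C @hGR @hGR₀ @hGR₁ @hGR₂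 @hGR₃ (ArchSideTerm.muSharp₂₃ @μ) (ArchSideTerm.hΔ₁_GOG_muSharp₂₃ @hGR @hGR₀ @hGR₁ @hGR₂ @hGR₃ @μ) (ArchSideTerm.hΔ₂_GOG_muSharp₂₃ @hGR @hGR₀ @hGR₁ @hGR₂ @hGR₃ @μ (ArchSideTerm.hSV_holds @hGR)) (ArchSideTerm.hΔ₃_GOG_muSharp₂₃ @hGR @hGR₀ @hGR₁ @hGR₂ @hGR₃ @μ (ArchSideTerm.hSV_holds @hGR))) V c))) (d12Of (ArchSideTerm.muSharp₂₃ @μ)) (d34Of (ArchSideTerm.muSharp₂₃ @μ))).Gen12FunBridge V c))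
    (real34 : ∀ {L : CMField} {ι₁ : L →+* ℂ} (V : HermSpace3 L ι₁) (c : SeesawCtx L),
      (thetaModelOf hHD hI h₁ (cmAbelianVarietyRealised_of_eigenbasis hHD hI h₃) (orientBitι L ι₁) (embOf hHD hI h₁ (cmAbelianVarietyRealised_of_eigenbasis hHD hI h₃)) (coverOf hHD hI h₁ (cmAbelianVarietyRealised_of_eigenbasis hHD hI h₃) hA) (wmOfInput (HypCensus.Wcm hGR (EtaChi.η (@SInstance.χVR @hGR @hGR₀ @hGR₁) (@SInstance.χWR @hGR @hGR₀ @hGR₁ (ArchSideTerm.muSharp₂₃ @μ))) (EtaChi.hη (@SInstance.χVR @hGR @hGR₀ @hGR₁) (@SInstance.χWR @hGR @hGR₀ @hGR₁ (ArchSideTerm.muSharp₂₃ @μ))) (EtaChi.hηc (@SInstance.χVR @hGR @hGR₀ @hGR₁) (@SInstance.χWR @hGR @hGR₀ @hGR₁ (ArchSideTerm.muSharp₂₃ @μ))))) (thetaOf _ (thetaClassInputOf _ (fun V c => thetaSpaceInputOf hHD hI h₁ (cmAbelianVarietyRealised_of_eigenbasis hHD hI h₃) (SInstance.SROGT'C @hGR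 @hGR₀ @hGR₁ @hGR₂ @hGR₃ (ArchSideTerm.muSharp₂₃ @μ) (ArchSideTerm.hΔ₁_GOG_muSharp₂₃ @hGR @hGR₀ @hGR₁ @hGR₂ @hGR₃ @μ) (ArchSideTerm.hΔ₂_GOG_muSharp₂₃ @hGR @hGR₀ @hGR₁ @hGR₂ @hGR₃ @μ (ArchSideTerm.hSV_holds @hGR)) (ArchSideTerm.hΔ₃_GOG_muSharp₂₃ @hGR @hGR₀ @hGR₁ @hGR₂ @hGR₃ @μ (ArchSideTerm.hSV_holds @hGR))) V c))) (d12Of (ArchSideTerm.muSharp₂₃ @μ)) (d34Of (ArchSideTerm.muSharp₂₃ @μ))).GoodCtx ι₁ c → Module.finrank ℚ c.K = 6 ∧ IsNormalClosure ℚ c.K L ∧ (Module.finrank ℚ L = 24 ∨ Module.finrank ℚ L = 48) →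
      (NumberField.InfinitePlace.mk ι₁).embedding = ι₁ →
      Nonempty ((thetaModelOf hHD hI h₁ (cmAbelianVarietyRealised_of_eigenbasis hHD hI h₃) (orientBitι L ι₁) (embOf hHD hI h₁ (cmAbelianVarietyRealised_of_eigenbasis hHD hI h₃)) (coverOf hHD hI h₁ (cmAbelianVarietyRealised_of_eigenbasis hHD hI h₃) hA) (wmOfInput (HypCensus.Wcm hGR (EtaChi.η (@SInstance.χVR @hGR @hGR₀ @hGR₁) (@SInstance.χWR @hGR @hGR₀ @hGR₁ (ArchSideTerm.muSharp₂₃ @μ))) (EtaChi.hη (@SInstance.χVR @hGR @hGR₀ @hGR₁) (@SInstance.χWR @hGR @hGR₀ @hGR₁ (ArchSideTerm.muSharp₂₃ @μ))) (EtaChi.hηc (@SInstance.χVR @hGR @hGR₀ @hGR₁) (@SInstance.χWR @hGR @hGR₀ @hGR₁ (ArchSideTerm.muSharp₂₃ @μ))))) (thetaOf _ (thetaClassInputOf _ (fun V c => thetaSpaceInputOf hHD hI h₁ (cmAbelianVarietyRealised_of_eigenbasis hHD hI h₃) (SInstance.SROGT'C @hGR @hGR₀ @hGR₁ @hGR₂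 @hGR₃ (ArchSideTerm.muSharp₂₃ @μ) (ArchSideTerm.hΔ₁_GOG_muSharp₂₃ @hGR @hGR₀ @hGR₁ @hGR₂ @hGR₃ @μ) (ArchSideTerm.hΔ₂_GOG_muSharp₂₃ @hGR @hGR₀ @hGR₁ @hGR₂ @hGR₃ @μ (ArchSideTerm.hSV_holds @hGR)) (ArchSideTerm.hΔ₃_GOG_muSharp₂₃ @hGR @hGR₀ @hGR₁ @hGR₂ @hGR₃ @μ (ArchSideTerm.hSV_holds @hGR))) V c))) (d12Of (ArchSideTerm.muSharp₂₃ @μ)) (d34Of (ArchSideTerm.muSharp₂₃ @μ))).Real34FunBridge V c)) :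
     (picardCMUniverse hHD hI h₁ (cmAbelianVarietyRealised_of_eigenbasis hHD hI h₃)).PerL
:=
  perL_picardCM_r21AEOGISTR2DJ hHD hI h₁ h₃ hA
    (HypCensus.Wcm hGR (EtaChi.η (@SInstance.χVR @hGR @hGR₀ @hGR₁) (@SInstance.χWR @hGR @hGR₀ @hGR₁ (ArchSideTerm.muSharp₂₃ @μ))) (EtaChi.hη (@SInstance.χVR @hGR @hGR₀ @hGR₁) (@SInstance.χWR @hGR @hGR₀ @hGR₁ (ArchSideTerm.muSharp₂₃ @μ))) (EtaChi.hηc (@SInstance.χVR @hGR @hGR₀ @hGR₁) (@SInstance.χWR @hGR @hGR₀ @hGR₁ (ArchSideTerm.muSharp₂₃ @μ))))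
    hGR hGR₀ hGR₁ hGR₂ hGR₃ μ hR hΘ gen12 real34
    (fun V c hc h6 hcan => HypCensus.hyp12_of_census_R1At_GOG hHD hI h₁ (cmAbelianVarietyRealised_of_eigenbasis hHD hI h₃) hA hGR hGR₀ hGR₁ hGR₂ hGR₃
      (SInstance.SROGT'C @hGR @hGR₀ @hGR₁ @hGR₂ @hGR₃ (ArchSideTerm.muSharp₂₃ @μ) (ArchSideTerm.hΔ₁_GOG_muSharp₂₃ @hGR @hGR₀ @hGR₁ @hGR₂ @hGR₃ @μ) (ArchSideTerm.hΔ₂_GOG_muSharp₂₃ @hGR @hGR₀ @hGR₁ @hGR₂ @hGR₃ @μ (ArchSideTerm.hSV_holds @hGR)) (ArchSideTerm.hΔ₃_GOG_muSharp₂₃ @hGR @hGR₀ @hGR₁ @hGR₂ @hGR₃ @μ (ArchSideTerm.hSV_holds @hGR)))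
      μ V c hc h6.1 hcan (fun _ _ => (0 : Fin 6)))
    (fun V c hc h6 hcan => HypCensus.hyp34_of_census_R1At_GOG hHD hI h₁ (cmAbelianVarietyRealised_of_eigenbasis hHD hI h₃) hA hGR hGR₀ hGR₁ hGR₂ hGR₃
      (SInstance.SROGT'C @hGR @hGR₀ @hGR₁ @hGR₂ @hGR₃ (ArchSideTerm.muSharp₂₃ @μ) (ArchSideTerm.hΔ₁_GOG_muSharp₂₃ @hGR @hGR₀ @hGR₁ @hGR₂ @hGR₃ @μ) (ArchSideTerm.hΔ₂_GOG_muSharp₂₃ @hGR @hGR₀ @hGR₁ @hGR₂ @hGR₃ @μ (ArchSideTerm.hSV_holds @hGR)) (ArchSideTerm.hΔ₃_GOG_muSharp₂₃ @hGR @hGR₀ @hGR₁ @hGR₂ @hGR₃ @μ (ArchSideTerm.hSV_holds @hGR)))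
      μ V c hc h6.1 hcan (fun _ _ => (0 : Fin 6)))

end Model

end HodgeCM
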